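import Literature.Computability.AlgebraicComplexity.TensorMultiples
import Literature.Computability.AlgebraicComplexity.TensorRestrictionRank
import Literature.Computability.AlgebraicComplexity.MonomialRestrictionProducts
import Literature.Computability.AlgebraicComplexity.RelativeExponentTriangle
import Literature.Computability.AlgebraicComplexity.RelativeExponentProofs
import Literature.Computability.AlgebraicComplexity.LaserAlgorithmAssembly
import Literature.Computability.AlgebraicComplexity.RectangularExponentCertTransfer
import Literature.Computability.AlgebraicComplexity.BorderRankCW
import HarnessLib

/-!
# Relative (common-factor) restriction bounds the asymptotic rank

Let `X`, `S` be 3-tensors (finite formats, any commutative semiring), `S` restricting to `⟨1⟩`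
(i.e. `S ≠ 0` over a field), and `m ∈ ℕ`.  A **relative restriction**
`⟨m⟩ ⊠ S ≥ X ⊠ S` — `m` copies of the common factor `S` restrict to `X ⊠ S` — forces

  `R(X^{⊠n}) ≤ m^n · R(S)` for every `n`, hence `R̃(X) ≤ m`

(`tensorRank_kroneckerPow_le_of_relativeRestriction`, `asymptoticRank_le_of_relativeRestriction`).
The point is that `m` may be much smaller than `R(X)`: the factor `S` is never paid for more than
once.  Specialised to Kronecker powers of one tensor `T` (`X = T^{⊠d}`, `S = T^{⊠j}`):

  `⟨m⟩ ⊠ T^{⊠j} ≥ T^{⊠d} ⊠ T^{⊠j}  ⟹  R(T^{⊠(n d)}) ≤ m^n · R(T^{⊠j})  ⟹  R̃(T)^d ≤ m`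

(`asymptoticRank_pow_le_of_relativeRestriction`), and for the little Coppersmith–Winograd tensor
`T = T_{cw,2}` (`asymptoticRank_cwTensor_two_pow_le_of_relativeRestriction`): a single identity
`⟨m⟩ ⊠ T_{cw,2}^{⊠j} ≥ T_{cw,2}^{⊠(d)} ⊠ T_{cw,2}^{⊠j}` with `m < 3.931^d` would improve the record
bound `R̃(T_{cw,2}) < 3.931` (Alman–Li 2026), `m^{1/d} < 3.2688` would improve `ω`, and `m = 3^d`
would give `R̃(T_{cw,2}) = 3`, i.e. `ω = 2` (Coppersmith–Winograd 1990 / BCS Ex. 15.24).  The value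
`m = 3^d` ("tight") is excluded for every `j` by a Kempf–Ness argument (this seat's paper, Thm. 16.17,
not formalised); every `m ≥ 3^d + 1` is open.  Smallest live instances: `(j,d,m) = (1,2,15)`
(`T^{⊠3} ≤ 15 · T`, 15 pieces `(A_i ⊗ B_i ⊗ C_i)·T` with `A_i, B_i, C_i ∈ K^{27×3}`; would give
`R̃ ≤ √15`), `(2,2,≤15)`, `(1,3,≤60)`.

The proofs are elementary bookkeeping in the restriction preorder: `⊠`-compatibility,
associativity/commutativity relabellings, `R(⟨m⟩ ⊠ Y) ≤ m · R(Y)`, and the root test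
`A^{nd} ≤ C·m^n ∀n ⟹ A^d ≤ m`.

## References
* V. Strassen, *The asymptotic spectrum of tensors*, J. reine angew. Math. 384 (1988) (`R̃`, `⊠`, `≤`).
* D. Coppersmith, S. Winograd, *Matrix multiplication via arithmetic progressions*, JSC 9 (1990), §6–7;
  P. Bürgisser, M. Clausen, M. A. Shokrollahi, *Algebraic Complexity Theory* (1997), Ex. 15.24
  (`R̃(T_{cw,2}) = 3 ⟹ ω = 2`).
* J. Alman, B. Li, arXiv:2605.21738 (2026), Thm. 1.3 (`R̃(T_{cw,2}) < 3.931`).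
-/

noncomputable section

open Filter Topology Finset

namespace Summit.MatrixMultiplication.MatrixMultiplication.Theorems

open Literature.Computability.AlgebraicComplexity

universe u

section RelativeRestriction

variable {K : Type u} [CommSemiring K]
variable {ι κ μ ι' κ' μ' : Type*} [Fintype ι] [Fintype κ] [Fintype μ] [Fintype ι'] [Fintype κ']
  [Fintype μ'] [DecidableEq ι] [DecidableEq κ] [DecidableEq μ] [DecidableEq ι'] [DecidableEq κ']
  [DecidableEq μ']

/-- `Y ⊠ ⟨1⟩ ≥ Y` (relabelling along `a ↦ (a, 0)`). -/
theorem soloRel_kronecker_unitTensor_one_restrictsTo (Y : ι → κ → μ → K) :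
    TensorRestrictsTo (kroneckerTensor Y (unitTensor K 1)) Y := by
  have h := tensorRestrictsTo_precomp (kroneckerTensor Y (unitTensor K 1))
    (fun a : ι => (a, (0 : Fin 1))) (fun b : κ => (b, (0 : Fin 1))) (fun c : μ => (c, (0 : Fin 1)))
  have key : (fun a b c => kroneckerTensor Y (unitTensor K 1) (a, (0 : Fin 1)) (b, (0 : Fin 1))
      (c, (0 : Fin 1))) = Y := by
    funext a b c
    simp
  rw [key] at h
  exact h

omit [DecidableEq ι'] [DecidableEq κ'] [DecidableEq μ'] in
/-- If `S ≥ ⟨1⟩` then `Y ⊠ S ≥ Y`, so `R(Y) ≤ R(Y ⊠ S)`. -/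
theorem soloRel_tensorRank_le_kronecker (Y : ι → κ → μ → K) (S : ι' → κ' → μ' → K)
    (hS : TensorRestrictsTo S (unitTensor K 1)) :
    tensorRank Y ≤ tensorRank (kroneckerTensor Y S) :=
  (((TensorRestrictsTo.refl Y).kronecker hS).trans
    (soloRel_kronecker_unitTensor_one_restrictsTo Y)).tensorRank_le

omit [Fintype ι'] [Fintype κ'] [Fintype μ'] [DecidableEq ι] [DecidableEq κ] [DecidableEq μ]
  [DecidableEq ι'] [DecidableEq κ'] [DecidableEq μ'] in
/-- `t ≥ t^{⊠1}` as a restriction. -/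
theorem soloRel_restrictsTo_kroneckerPow_one (t : ι → κ → μ → K) :
    TensorRestrictsTo t (kroneckerPow t 1) :=
  (tensorMonRestrictsTo_kroneckerPow_one t).tensorRestrictsTo

/-- The one-step relative chain: from `⟨m⟩ ⊠ S ≥ X ⊠ S`,
`⟨m⟩ ⊠ (X^{⊠n} ⊠ S) ≥ X^{⊠(n+1)} ⊠ S` (reassociate, commute, apply the hypothesis in the
middle, merge the powers). -/
theorem soloRel_step (X : ι → κ → μ → K) (S : ι' → κ' → μ' → K) (m : ℕ)
    (h : TensorRestrictsTo (kroneckerTensor (unitTensor K m) S) (kroneckerTensor X S)) (n : ℕ) :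
    TensorRestrictsTo (kroneckerTensor (unitTensor K m) (kroneckerTensor (kroneckerPow X n) S))
      (kroneckerTensor (kroneckerPow X (n + 1)) S) := by
  refine (tensorRestrictsTo_kronecker_assoc K (unitTensor K m) (kroneckerPow X n) S).trans ?_
  refine (((tensorRestrictsTo_kronecker_comm K (unitTensor K m) (kroneckerPow X n)).kronecker
    (TensorRestrictsTo.refl S)).trans ?_)
  refine (tensorRestrictsTo_kronecker_assoc' K (kroneckerPow X n) (unitTensor K m) S).trans ?_
  refine ((TensorRestrictsTo.refl (kroneckerPow X n)).kronecker h).trans ?_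
  refine (tensorRestrictsTo_kronecker_assoc K (kroneckerPow X n) X S).trans ?_
  refine (((TensorRestrictsTo.refl (kroneckerPow X n)).kronecker
    (soloRel_restrictsTo_kroneckerPow_one X)).kronecker (TensorRestrictsTo.refl S)).trans ?_
  exact (tensorMonRestrictsTo_kroneckerPow_add' X n 1).tensorRestrictsTo.kronecker
    (TensorRestrictsTo.refl S)

/-- **Relative restriction bounds the ranks of powers**: `⟨m⟩ ⊠ S ≥ X ⊠ S` implies
`R(X^{⊠n} ⊠ S) ≤ m^n · R(S)` for all `n` — the common factor `S` is paid for once. -/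
theorem tensorRank_kroneckerPow_kronecker_le_of_relativeRestriction (X : ι → κ → μ → K)
    (S : ι' → κ' → μ' → K) (m : ℕ)
    (h : TensorRestrictsTo (kroneckerTensor (unitTensor K m) S) (kroneckerTensor X S)) (n : ℕ) :
    tensorRank (kroneckerTensor (kroneckerPow X n) S) ≤ m ^ n * tensorRank S := by
  induction n with
  | zero =>
    have key : (fun a b c => S (Prod.snd a) (Prod.snd b) (Prod.snd c)) =
        kroneckerTensor (kroneckerPow X 0) S := by
      funext a b c
      simp [kroneckerTensor_apply, kroneckerPow_apply]
    have hr : TensorRestrictsTo S (kroneckerTensor (kroneckerPow X 0) S) := by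
      have := tensorRestrictsTo_precomp S (fun a : (Fin 0 → ι) × ι' => a.2)
        (fun b : (Fin 0 → κ) × κ' => b.2) (fun c : (Fin 0 → μ) × μ' => c.2)
      rw [key] at this
      exact this
    simpa using hr.tensorRank_le
  | succ n ih =>
    calc tensorRank (kroneckerTensor (kroneckerPow X (n + 1)) S)
        ≤ tensorRank (kroneckerTensor (unitTensor K m) (kroneckerTensor (kroneckerPow X n) S)) :=
          (soloRel_step X S m h n).tensorRank_le
      _ ≤ m * tensorRank (kroneckerTensor (kroneckerPow X n) S) := tensorRank_multiple_le _ _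
      _ ≤ m * (m ^ n * tensorRank S) := Nat.mul_le_mul_left _ ih
      _ = m ^ (n + 1) * tensorRank S := by ring

/-- **Relative restriction bounds the ranks of powers of `X` itself** (`S ≥ ⟨1⟩`):
`R(X^{⊠n}) ≤ m^n · R(S)`. -/
theorem tensorRank_kroneckerPow_le_of_relativeRestriction (X : ι → κ → μ → K)
    (S : ι' → κ' → μ' → K) (m : ℕ) (hS : TensorRestrictsTo S (unitTensor K 1))
    (h : TensorRestrictsTo (kroneckerTensor (unitTensor K m) S) (kroneckerTensor X S)) (n : ℕ) :
    tensorRank (kroneckerPow X n) ≤ m ^ n * tensorRank S :=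
  (soloRel_tensorRank_le_kronecker _ S hS).trans
    (tensorRank_kroneckerPow_kronecker_le_of_relativeRestriction X S m h n)

omit [Fintype ι'] [Fintype κ'] [Fintype μ'] [DecidableEq ι] [DecidableEq κ] [DecidableEq μ]
  [DecidableEq ι'] [DecidableEq κ'] [DecidableEq μ'] in
/-- Root test: if `R(t^{⊠(n·d)}) ≤ C · m^n` for all `n` and `d ≥ 1`, then `R̃(t)^d ≤ m`. -/
theorem asymptoticRank_pow_le_of_tensorRank_kroneckerPow_mul_le (t : ι → κ → μ → K) {d : ℕ}
    (hd : 1 ≤ d) {C m : ℕ} (h : ∀ n : ℕ, tensorRank (kroneckerPow t (n * d)) ≤ C * m ^ n) :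
    asymptoticRank t ^ d ≤ m := by
  set A := asymptoticRank t with hAdef
  have hA0 : 0 ≤ A := asymptoticRank_nonneg t
  have hbdd : BddBelow (Set.range fun N : ℕ =>
      ((tensorRank (kroneckerPow t (N + 1)) : ℝ) ^ ((N : ℝ) + 1)⁻¹)) :=
    ⟨0, by rintro _ ⟨N, rfl⟩; positivity⟩
  -- `A^(n d) ≤ C m^n` for `n ≥ 1`
  have hApow : ∀ n : ℕ, 1 ≤ n → (A ^ d) ^ n ≤ (C : ℝ) * (m : ℝ) ^ n := by
    intro n hn
    obtain ⟨N, hN⟩ : ∃ N : ℕ, n * d = N + 1 :=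
      ⟨n * d - 1, by have := Nat.mul_le_mul hn hd; omega⟩
    have h1 : A ≤ ((tensorRank (kroneckerPow t (N + 1)) : ℝ) ^ ((N : ℝ) + 1)⁻¹) := ciInf_le hbdd N
    have h2 := h n
    rw [hN] at h2
    have h4 : (N : ℝ) + 1 = ((N + 1 : ℕ) : ℝ) := by push_cast; ring
    calc (A ^ d) ^ n = A ^ (N + 1) := by rw [← pow_mul, mul_comm, hN]
      _ ≤ (((tensorRank (kroneckerPow t (N + 1)) : ℝ) ^ ((N : ℝ) + 1)⁻¹)) ^ (N + 1) :=
          pow_le_pow_left₀ hA0 h1 _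
      _ = tensorRank (kroneckerPow t (N + 1)) := by
          rw [h4, Real.rpow_inv_natCast_pow (Nat.cast_nonneg _) (Nat.succ_ne_zero N)]
      _ ≤ ((C * m ^ n : ℕ) : ℝ) := by exact_mod_cast h2
      _ = (C : ℝ) * (m : ℝ) ^ n := by push_cast; ring
  by_contra hlt
  rw [not_le] at hlt
  have hm0 : (0 : ℝ) ≤ m := Nat.cast_nonneg m
  rcases Nat.eq_zero_or_pos m with hm | hmpos
  · have h1 := hApow 1 le_rfl
    rw [hm] at h1 hlt
    simp only [pow_one, mul_zero, CharP.cast_eq_zero] at h1 hlt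
    exact absurd h1 (not_le.2 hlt)
  · have hm0' : (0 : ℝ) < m := by exact_mod_cast hmpos
    set a : ℝ := A ^ d / m with ha
    have ha1 : 1 < a := (one_lt_div hm0').2 hlt
    have hAa : A ^ d = a * m := by rw [ha, div_mul_cancel₀ _ hm0'.ne']
    have hpow' : ∀ n : ℕ, 1 ≤ n → a ^ n ≤ C := by
      intro n hn
      have h1 := hApow n hn
      rw [hAa, mul_pow] at h1
      exact le_of_mul_le_mul_right h1 (pow_pos hm0' _)
    have hlim : Tendsto (fun n : ℕ => a ^ (n + 1)) atTop atTop :=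
      (tendsto_pow_atTop_atTop_of_one_lt ha1).comp (tendsto_add_atTop_nat 1)
    obtain ⟨n, hn⟩ := (hlim.eventually (eventually_gt_atTop (C : ℝ))).exists
    exact absurd (hpow' (n + 1) (Nat.succ_pos n)) (not_le.2 hn)

/-- **`⟨m⟩ ⊠ S ≥ X ⊠ S` with `S ≥ ⟨1⟩` implies `R̃(X) ≤ m`.** -/
theorem asymptoticRank_le_of_relativeRestriction (X : ι → κ → μ → K) (S : ι' → κ' → μ' → K)
    (m : ℕ) (hS : TensorRestrictsTo S (unitTensor K 1))
    (h : TensorRestrictsTo (kroneckerTensor (unitTensor K m) S) (kroneckerTensor X S)) :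
    asymptoticRank X ≤ m := by
  have := asymptoticRank_pow_le_of_tensorRank_kroneckerPow_mul_le X (d := 1) le_rfl
    (C := tensorRank S) (m := m) (fun n => by
      rw [mul_one, mul_comm]
      exact tensorRank_kroneckerPow_le_of_relativeRestriction X S m hS h n)
  simpa using this

/-- **Relative self-bounding for one tensor**: if `T ≥ ⟨1⟩`, `d ≥ 1` and
`⟨m⟩ ⊠ T^{⊠j} ≥ T^{⊠d} ⊠ T^{⊠j}` ("`T^{⊠(j+d)} ≤ m · T^{⊠j}`"), then `R(T^{⊠(n d)}) ≤ m^n R(T^{⊠j})`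
for all `n`, and so `R̃(T)^d ≤ m`. -/
theorem asymptoticRank_pow_le_of_relativeRestriction (T : ι → κ → μ → K) (j d m : ℕ)
    (hd : 1 ≤ d) (hT : TensorRestrictsTo T (unitTensor K 1))
    (h : TensorRestrictsTo (kroneckerTensor (unitTensor K m) (kroneckerPow T j))
      (kroneckerTensor (kroneckerPow T d) (kroneckerPow T j))) :
    asymptoticRank T ^ d ≤ m := by
  -- `T^{⊠j} ≥ ⟨1⟩^{⊠j} ≥ ⟨1⟩`
  have hS : TensorRestrictsTo (kroneckerPow T j) (unitTensor K 1) := by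
    refine (hT.kroneckerPow j).trans ?_
    have := tensorRestrictsTo_precomp (kroneckerPow (unitTensor K 1) j) (fun a : Fin 1 => fun _ => a)
      (fun b : Fin 1 => fun _ => b) (fun c : Fin 1 => fun _ => c)
    have key : (fun a b c => kroneckerPow (unitTensor K 1) j (fun _ : Fin j => a) (fun _ => b)
        (fun _ => c)) = unitTensor K 1 := by
      funext a b c
      rw [Subsingleton.elim a 0, Subsingleton.elim b 0, Subsingleton.elim c 0]
      simp
    rw [key] at this
    exact this
  refine asymptoticRank_pow_le_of_tensorRank_kroneckerPow_mul_le T hd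
    (C := tensorRank (kroneckerPow T j)) (m := m) (fun n => ?_)
  -- `R(T^{⊠(n d)}) ≤ R((T^{⊠d})^{⊠n}) ≤ m^n R(T^{⊠j})`
  calc tensorRank (kroneckerPow T (n * d))
      ≤ tensorRank (kroneckerPow (kroneckerPow T d) n) :=
        (tensorMonRestrictsTo_kroneckerPow_mul' T n d).tensorRestrictsTo.tensorRank_le
    _ ≤ m ^ n * tensorRank (kroneckerPow T j) :=
        tensorRank_kroneckerPow_le_of_relativeRestriction _ _ m hS h n
    _ = tensorRank (kroneckerPow T j) * m ^ n := mul_comm _ _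

/-- `T_{cw,2} ≥ ⟨1⟩` (the entry `T_{cw,2}(0,1,1) = 1`). -/
theorem cwTensor_two_restrictsTo_unitTensor_one :
    TensorRestrictsTo (cwTensor K 2) (unitTensor K 1) := by
  have := tensorRestrictsTo_precomp (cwTensor K 2) (fun _ : Fin 1 => (0 : Fin 3))
    (fun _ : Fin 1 => (1 : Fin 3)) (fun _ : Fin 1 => (1 : Fin 3))
  have key : (fun a b c : Fin 1 => cwTensor K 2 ((fun _ : Fin 1 => (0 : Fin 3)) a)
      ((fun _ : Fin 1 => (1 : Fin 3)) b) ((fun _ : Fin 1 => (1 : Fin 3)) c)) = unitTensor K 1 := by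
    funext a b c
    rw [Subsingleton.elim a 0, Subsingleton.elim b 0, Subsingleton.elim c 0]
    simp [cwTensor]
  rw [key] at this
  exact this

/-- **The relative door for `T_{cw,2}`**: a relative restriction
`⟨m⟩ ⊠ T_{cw,2}^{⊠j} ≥ T_{cw,2}^{⊠d} ⊠ T_{cw,2}^{⊠j}` (`m` copies of `T_{cw,2}^{⊠j}` restrict to
`T_{cw,2}^{⊠(d+j)}`), for any `j` and `d ≥ 1`, gives `R̃(T_{cw,2})^d ≤ m` over any commutative
semiring.  (`m = 3^d` would mean `R̃(T_{cw,2}) = 3`, whence `ω = 2` over `ℂ`.) -/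
theorem asymptoticRank_cwTensor_two_pow_le_of_relativeRestriction (j d m : ℕ) (hd : 1 ≤ d)
    (h : TensorRestrictsTo (kroneckerTensor (unitTensor K m) (kroneckerPow (cwTensor K 2) j))
      (kroneckerTensor (kroneckerPow (cwTensor K 2) d) (kroneckerPow (cwTensor K 2) j))) :
    asymptoticRank (cwTensor K 2) ^ d ≤ m :=
  asymptoticRank_pow_le_of_relativeRestriction _ j d m hd cwTensor_two_restrictsTo_unitTensor_one h

end RelativeRestriction

end Summit.MatrixMultiplication.MatrixMultiplication.Theorems
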